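import Summits.QuantumFields.YangMills.Theorems.BalabanUVNodesN18GeometricIncrementsOfLocalTerms

/-!
# BalabanUVNodes ∕ N18 (node U3's kernel objects) — (P2) AT TERM LEVEL: W1-21's `GeometricIncrements(OfRecord₁₃)` for the (1.7) localized sum from a LOCAL DOMAIN MATCHING between
# consecutive tori (displayed lattice geometry) + a PER-TERM volume-independence rate; the K-uniform LOCAL COUNT proved
# (Track A, DAG node N18 = NE5 ∕ node U3's letters; key K3⁸ `SpineGivenEndpointR13SepCoPHV` = stmt-QuantumFields-27366; cell `pub-ymgap`, WIDTH SEAT `pub-ymgap-dag-n18-w2` g10,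
# FILE 4; `--kind proof --supports stmt-QuantumFields-27366 --as helper`, COUNT-NEUTRAL; THEOREMS ONLY, 0 `def`, 0 `sorry`)

WHY.  g9's FILE 7 (`…N18GeometricIncrementsOfLocalTerms`) produces W1-21's finite-volume stabilisation letter from the localized representation with ONE displayed row that is still a
statement about SUMS: the local stability rate `|S^{loc}_R(K+1) − S^{loc}_R(K)| ≤ A e^{aR} ω^K` of the `R`-truncated window sums (domains with `d(X) ≤ R` and `distCT(cast site 0, X) ≤ R`).
After g10 FILES 1–3 (`…N18U3LettersOfLocalTermsPackage{,Pins,Generic}`) it is the only row of node U3's data list that is not TERM-level.  What is behind it ([II] (2.13)–(2.14), [I] p. 264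
«this limit exists by the localized representation (1.7)»): for `K` large against `R` the small domains near the window site of the torus `T^{(k+1)}_K` and of `T^{(k+1)}_{K+1}` are THE
SAME domains of `ℤ⁴` (lift and re-project — lattice geometry, the volume twin of def-W1's run matching `RateRecordW1Maps.domSys_succ`), and the (2.13) term of a matched small domain computed in
the two volumes differs by a geometrically small amount (the term reads the minimizer on a neighbourhood of `X`, and the minimizers of the two volumes agree there up to `e^{−δ₀·(distance to
where the volumes differ)}`).  THIS FILE displays exactly these two TERM-level inputs — a matching `φ k K : 𝐃_{k+1}(T_K) → 𝐃_{k+1}(T_{K+1})` restricting, for `K ≥ K_m` and `R ≤ c_ρK`, to a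
bijection between the `R`-local domains, and a per-term rate `|polScalar(term_{K+1}(φX))(z,0) − polScalar(term_K(X))(z,0)| ≤ A₁ω^K` on the `R`-local `X` — PROVES the K-uniform local count
`#{R-local X} ≤ N₀e^{a₀R}` (dag-n22-w2's resummation `le_softSum_resum` read as a COUNT), and concludes W1-21's letter through a DIAGONAL edition of g9's two-scale lemma (the stability
hypothesis is only ever used at `R = cK`).

WHAT (`M = L^{m′}`; `a₀ := 2κ₀(64,8) + 4`, `N₀ := e^{12Mδ₁″}K₀(64,8)K₁(4,1)`, `δ₁″ = delta1 2 (2κ₀) (4M)`; `a′ := max{a₀, −log ω∕(2c_ρ)}`, `c′ = −log ω∕(2(a′+1)) < c_ρ`, `r = max{ω^{1∕2}, e^{−ηc′}}`,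
`η = min{κ,δ₀}∕2`):
§1 `abs_sub_le_geometric_of_twoScale_diag` (real analysis; g9's lemma with the stability hypothesis on the diagonal only) · §2 `abs_sum_sub_sum_le_card_mul_of_bijOn` (finite sums matched by a
`Set.BijOn`) · §3 ★ `card_localDomains_le` (THE LOCAL COUNT, proved) · §4 ★★★ `geometricIncrements_localizedSum_of_termwiseVolumeRate` (generic window `W`) · ★★★
`geometricIncrementsOfRecord₁₃_of_termwiseVolumeRate` (RECORD, under W1-20's law).

HONEST FRAMING — what this is NOT.  Count-neutral: the local count, the reindexing and the two-scale real analysis are proved; the MATCHING (pure lattice geometry of the torus catalogues —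
definer-lane content, NOT asserted here) and the PER-TERM volume-independence rate (NODE A ∕ N10 content) are DISPLAYED hypotheses, as are the `C²` charts and soft value majorants of FILE 7;
NO estimate of Bałaban's is proved or asserted; nothing constructed; no letter OF RECORD inhabited; N18 ∕ N22 ∕ (D4) NOT discharged; K3⁸ OPEN (skeleton v6 untouched), not claimed; counts UNMOVED
(typed 28∕28 · discharged 5∕27 (A 5∕28)); one finite four-torus programme at fixed ε, Bałaban AS PRINTED; R4 closes the conditional finite-𝕋⁴ rung `BalabanLadder.UV` only — NOT ℝ⁴, NOT infinite
volume, NOT OS, NOT a mass gap; the Clay problem is NOT proved by any of this.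

References (TYPES only): [I] = [Balaban1987RG1] (1.7) p. 261, (1.18) p. 263, (1.20)–(1.21) p. 264, (5.10) p. 293; [II] = [Balaban1988RG2Cluster] (2.13)–(2.14) pp. 14–15.  Imports g9 FILE 7
(through it FILES 5∕6, dag-n22-w2's storeys, def-W1's files) BY NAME; nothing re-declared.
-/

noncomputable section

namespace YMDAG.N18.LocalStabilityRateOfTermwise

open Filter Metric
open scoped BigOperators Topology
open Literature.MathematicalPhysics.QuantumFieldTheory.Balaban1983to89
open Literature.MathematicalPhysics.QuantumFieldTheory.Balaban1983to89.T4Continuum (T4Family)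
open Literature.MathematicalPhysics.QuantumFieldTheory.Balaban1983to89.B12Sec2to5 (l1)
open Literature.MathematicalPhysics.QuantumFieldTheory.Balaban1983to89.B12PolarizationTensor120 (polComp expChart)
open Literature.MathematicalPhysics.QuantumFieldTheory.Balaban1983to89.Node00 (Stage13Params polScalar polWindow siteOfInt MatA)
open Literature.MathematicalPhysics.QuantumFieldTheory.Balaban1983to89.Node00.U3OfKernels (histPrefix)
open Literature.MathematicalPhysics.QuantumFieldTheory.Balaban1983to89.Node00.U3KernelLetters (GeometricIncrements GeometricIncrementsOfRecord₁₃ geometricIncrementsOfRecord₁₃_iff_of_localizes)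
open Literature.MathematicalPhysics.QuantumFieldTheory.Balaban1983to89.Node00.LocalizedSum17 (localizedSum ReadingMaps Localizes17OfRecord₁₃)
open Literature.MathematicalPhysics.QuantumFieldTheory.Balaban1983to89.Node00.Sect2 (domSys domCount)
open Literature.MathematicalPhysics.QuantumFieldTheory.Balaban1983to89.Node00.W1 (ClusterTower)
open Literature.MathematicalPhysics.QuantumFieldTheory.Balaban1983to89.T4OutputRate (Window)
open Literature.MathematicalPhysics.QuantumFieldTheory.Balaban1983to89.B12Decay510 (delta1 delta1_nonneg delta1_le_half delta1_mul_le)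
open Literature.MathematicalPhysics.QuantumFieldTheory.Balaban1983to89.B12Decay510Window (K₁)
open Literature.MathematicalPhysics.QuantumFieldTheory.Balaban1983to89.B12Decay510Torus (pl1 pl1_nonneg distCT nearT distCT_nonneg geomT geomLeafT cubeSumLeafT treeLeafT)
open Literature.MathematicalPhysics.QuantumFieldTheory.Balaban1983to89.B12TreeDecay (K₀ kappa₀ K₀_pos kappa₀_nonneg)
open Literature.MathematicalPhysics.QuantumFieldTheory.Balaban1983to89.TreeLengthTorus (TPt torusTreeLen torusTreeLen_nonneg)
open YMDAG.N22.WindowSoftTwoPoint (le_softSum_resum)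
open YMDAG.N18.GeometricIncrementsOfLocalTerms (eventually_forall_abs_polWindow_sub_localTruncated_le twoScaleRate_lt_one)

/-! ## §1 Real analysis: two scales ⇒ geometric increments, the stability hypothesis ON THE DIAGONAL only -/

/-- **TWO SCALES ⇒ GEOMETRIC INCREMENTS, DIAGONAL EDITION**: as g9's `abs_sub_le_geometric_of_twoScale`, but the increments of `s_R` are asked only at `R = cK`, `c := −log ω ∕ (2(a+1))`
(which is all the proof ever uses): `|s_{cK}(K+1) − s_{cK}(K)| ≤ A e^{acK} ω^K` for `K ≥ K₁`, together with the two-sided tail `|u(K) − s_R(K)| ≤ C_t e^{−ηR}` for all `K ≥ K₁`, `R ≥ 0`,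
give `|u(K+1) − u(K)| ≤ (2C_t + A)·r^K`, `r = max{e^{(log ω)∕2}, e^{−ηc}}`. [folklore] -/
theorem abs_sub_le_geometric_of_twoScale_diag {u : ℕ → ℝ} {s : ℝ → ℕ → ℝ} {K₁ : ℕ} {Ct η A a ω : ℝ} (hCt : 0 ≤ Ct) (hA : 0 ≤ A) (ha : 0 ≤ a)
    (hω : 0 < ω) (hω1 : ω < 1)
    (htail : ∀ K, K₁ ≤ K → ∀ R : ℝ, 0 ≤ R → |u K - s R K| ≤ Ct * Real.exp (-η * R))
    (hstab : ∀ K, K₁ ≤ K → |s (-Real.log ω / (2 * (a + 1)) * K) (K + 1) - s (-Real.log ω / (2 * (a + 1)) * K) K| ≤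
      A * Real.exp (a * (-Real.log ω / (2 * (a + 1)) * K)) * ω ^ K) (K : ℕ) (hK : K₁ ≤ K) :
    |u (K + 1) - u K| ≤ (2 * Ct + A) * (max (Real.exp (Real.log ω / 2)) (Real.exp (-η * (-Real.log ω / (2 * (a + 1)))))) ^ K := by
  have hlog : Real.log ω < 0 := Real.log_neg hω hω1
  set c : ℝ := -Real.log ω / (2 * (a + 1)) with hc
  have hc0 : 0 < c := by rw [hc]; exact div_pos (by linarith) (by linarith)
  set r₁ : ℝ := Real.exp (Real.log ω / 2) with hr₁
  set r₂ : ℝ := Real.exp (-η * c) with hr₂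
  have hR0 : 0 ≤ c * K := mul_nonneg hc0.le (Nat.cast_nonneg K)
  have h1 := htail (K + 1) (le_trans hK (Nat.le_succ K)) (c * K) hR0
  have h2 := hstab K hK
  have h3 := htail K hK (c * K) hR0
  have e2 : Real.exp (-η * (c * K)) = r₂ ^ K := by
    rw [hr₂, ← Real.exp_nat_mul]; congr 1; ring
  have e1 : Real.exp (a * (c * K)) * ω ^ K ≤ r₁ ^ K := by
    have hωK : ω ^ K = Real.exp (K * Real.log ω) := by rw [Real.exp_nat_mul, Real.exp_log hω]
    rw [hωK, ← Real.exp_add, hr₁, ← Real.exp_nat_mul]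
    refine Real.exp_le_exp.2 ?_
    have hac : a * c ≤ -Real.log ω / 2 := by
      rw [hc, show a * (-Real.log ω / (2 * (a + 1))) = (-Real.log ω / 2) * (a / (a + 1)) by field_simp]
      have : a / (a + 1) ≤ 1 := (div_le_one (by linarith)).2 (by linarith)
      have h0 : 0 ≤ -Real.log ω / 2 := by linarith
      nlinarith
    have hK0 : (0 : ℝ) ≤ K := Nat.cast_nonneg K
    nlinarith
  have hr₁r : r₁ ^ K ≤ (max r₁ r₂) ^ K := pow_le_pow_left₀ (Real.exp_pos _).le (le_max_left _ _) K
  have hr₂r : r₂ ^ K ≤ (max r₁ r₂) ^ K := pow_le_pow_left₀ (Real.exp_pos _).le (le_max_right _ _) K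
  have h2' : |s (c * K) (K + 1) - s (c * K) K| ≤ A * Real.exp (a * (c * K)) * ω ^ K := by
    have e : -Real.log ω / (2 * (a + 1)) * K = c * K := by rw [hc]
    rw [e] at h2; exact h2
  calc |u (K + 1) - u K| = |(u (K + 1) - s (c * K) (K + 1)) + (s (c * K) (K + 1) - s (c * K) K) + (s (c * K) K - u K)| := by ring_nf
    _ ≤ |u (K + 1) - s (c * K) (K + 1)| + |s (c * K) (K + 1) - s (c * K) K| + |s (c * K) K - u K| :=
        (abs_add_le _ _).trans (add_le_add (abs_add_le _ _) le_rfl)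
    _ ≤ Ct * Real.exp (-η * (c * K)) + A * Real.exp (a * (c * K)) * ω ^ K + Ct * Real.exp (-η * (c * K)) := by
        rw [abs_sub_comm (s (c * K) K) (u K)]; exact add_le_add (add_le_add h1 h2') h3
    _ ≤ Ct * (max r₁ r₂) ^ K + A * (max r₁ r₂) ^ K + Ct * (max r₁ r₂) ^ K := by
        rw [e2, mul_assoc]
        exact add_le_add (add_le_add (mul_le_mul_of_nonneg_left hr₂r hCt) (mul_le_mul_of_nonneg_left (e1.trans hr₁r) hA))
          (mul_le_mul_of_nonneg_left hr₂r hCt)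
    _ = (2 * Ct + A) * (max r₁ r₂) ^ K := by ring

/-- If `a′ ≥ −log ω ∕ (2c_ρ)` (`0 < ω < 1`, `c_ρ > 0`) then the two-scale radius `c′ = −log ω ∕ (2(a′+1))` is `≤ c_ρ`. [folklore] -/
theorem twoScale_c_le {a' ω cρ : ℝ} (hω : 0 < ω) (hω1 : ω < 1) (hcρ : 0 < cρ) (ha' : -Real.log ω / (2 * cρ) ≤ a') :
    -Real.log ω / (2 * (a' + 1)) ≤ cρ := by
  have hlog : 0 < -Real.log ω := by have := Real.log_neg hω hω1; linarith
  have ha'0 : 0 < a' + 1 := by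
    have : 0 ≤ -Real.log ω / (2 * cρ) := div_nonneg hlog.le (by linarith)
    linarith
  rw [div_le_iff₀ (by linarith)]
  rw [div_le_iff₀ (by linarith)] at ha'
  nlinarith

/-! ## §2 Finite sums matched by a bijection -/

/-- Two finite sums whose index sets are matched by a `Set.BijOn φ` differ by at most `#s · ε` when the matched summands differ by at most `ε` (`Finset.sum_nbij`). [folklore] -/
theorem abs_sum_sub_sum_le_card_mul_of_bijOn {α β : Type*} (s : Finset α) (t : Finset β) (φ : α → β) (h : Set.BijOn φ ↑s ↑t) (f : α → ℝ) (g : β → ℝ)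
    {ε : ℝ} (hb : ∀ X ∈ s, |g (φ X) - f X| ≤ ε) : |∑ Y ∈ t, g Y - ∑ X ∈ s, f X| ≤ s.card * ε := by
  have hre : ∑ X ∈ s, g (φ X) = ∑ Y ∈ t, g Y :=
    Finset.sum_nbij φ (fun a ha => Finset.mem_coe.1 (h.mapsTo (Finset.mem_coe.2 ha))) h.injOn h.surjOn (fun _ _ => rfl)
  rw [← hre, ← Finset.sum_sub_distrib]
  calc |∑ X ∈ s, (g (φ X) - f X)| ≤ ∑ X ∈ s, |g (φ X) - f X| := Finset.abs_sum_le_sum_abs _ _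
    _ ≤ ∑ X ∈ s, ε := Finset.sum_le_sum hb
    _ = s.card * ε := by rw [Finset.sum_const, nsmul_eq_mul]

/-! ## §3 The K-uniform LOCAL COUNT on the torus catalogue of record (dag-n22-w2's resummation read as a count) -/

section Count

variable (F : T4Family) (M : ℕ) [NeZero M]

open Classical in
/-- ★ **THE LOCAL COUNT**: on the torus catalogue `𝐃_{k+1}(T_K)` of record (M-cube domains, tree length `d`), the number of domains with `d(X) ≤ R` whose nearest cube is within `distCT ≤ R`
of the cast window site `0` is `≤ e^{a₀R}·N₀` (any real `R`), `a₀ = 2κ₀(64,8) + 4`, `N₀ = e^{12Mδ₁″}K₀(64,8)K₁(4, 2∕2)` (`δ₁″ = delta1 2 (2κ₀) (4M)`), UNIFORMLY in `K` and `k`: the indicator of the local set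
is `≤ e^{a₀R}e^{−2κ₀d(X)}e^{−2dist}e^{−2dist}`, and dag-n22-w2's `le_softSum_resum` sums the soft weights on the cast torus `(ℤ∕domCount·M)⁴` with the leaves `geomLeafT ∕ cubeSumLeafT ∕
treeLeafT`. [cite: Balaban1987RG1, (0.26) pp.257-258 and (5.10) p.293] -/
theorem card_localDomains_le (k K : ℕ) (R : ℝ) :
    ((Finset.univ.filter (fun X : (domSys (F.P K) M (k + 1)).Dom =>
        ¬ (R < torusTreeLen X.1 ∨ R < distCT (domCount (F.P K) M (k + 1)) M
          (fun i : Fin 4 => (ZMod.cast (siteOfInt F K (k + 1) 0 i) : ZMod (domCount (F.P K) M (k + 1) * M)))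
          (nearT (M := M) (fun i : Fin 4 => (ZMod.cast (siteOfInt F K (k + 1) 0 i) : ZMod (domCount (F.P K) M (k + 1) * M))) X)))).card : ℝ) ≤
      Real.exp ((2 * kappa₀ (4 * 2 ^ 4) (2 * 4) + 4) * R) *
        (Real.exp (delta1 2 (2 * kappa₀ (4 * 2 ^ 4) (2 * 4)) ((M : ℝ) * 4) * ((M : ℝ) * 4) * 3) * K₀ (4 * 2 ^ 4) (2 * 4) * K₁ 4 (2 / 2)) := by
  have hk0 : 0 ≤ kappa₀ (4 * 2 ^ 4) (2 * 4) := kappa₀_nonneg (by norm_num) _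
  set κ' : ℝ := 2 * kappa₀ (4 * 2 ^ 4) (2 * 4) with hκ'
  have hκ'0 : 0 ≤ κ' := by rw [hκ']; positivity
  have hκ'h : kappa₀ (4 * 2 ^ 4) (2 * 4) ≤ κ' / 2 := by rw [hκ']; linarith
  have hMd : (0 : ℝ) < ((M : ℕ) : ℝ) * ((4 : ℕ) : ℝ) := mul_pos (Nat.cast_pos.2 (Nat.pos_of_neZero _)) (by norm_num)
  set x₀ : TPt 4 (domCount (F.P K) M (k + 1) * M) :=
    fun i : Fin 4 => (ZMod.cast (siteOfInt F K (k + 1) 0 i) : ZMod (domCount (F.P K) M (k + 1) * M)) with hx₀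
  -- the count as a sum of indicators
  have hcard : ((Finset.univ.filter (fun X : (domSys (F.P K) M (k + 1)).Dom =>
        ¬ (R < torusTreeLen X.1 ∨ R < distCT (domCount (F.P K) M (k + 1)) M x₀ (nearT (M := M) x₀ X)))).card : ℝ) ≤
      ∑ X : (domSys (F.P K) M (k + 1)).Dom, (if ¬ (R < torusTreeLen X.1 ∨ R < distCT (domCount (F.P K) M (k + 1)) M x₀ (nearT (M := M) x₀ X)) then (1 : ℝ) else 0) := by
    rw [Finset.card_filter, Nat.cast_sum]
    refine Finset.sum_le_sum fun X _ => ?_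
    split_ifs <;> simp
  have h := le_softSum_resum (geomT 4 (domCount (F.P K) M (k + 1)) M) (dist := fun x y => pl1 (x - y))
    (CE := Real.exp ((κ' + 4) * R)) (κ := κ') (δ₀ := 2)
    (Real.exp_pos _).le (K₀_pos _ _).le (delta1_nonneg (by norm_num) hκ'0 hMd) (delta1_le_half 2 κ' _) (delta1_mul_le 2 κ' hMd)
    (geomLeafT 4 _ M) (cubeSumLeafT 4 _ M (half_pos two_pos)) (treeLeafT 4 _ hκ'h) x₀ x₀ hcard (fun X => ?_)
  · refine h.trans ?_
    have hexp1 : Real.exp (-delta1 2 κ' (((M : ℕ) : ℝ) * ((4 : ℕ) : ℝ)) * pl1 (x₀ - x₀)) ≤ 1 :=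
      Real.exp_le_one_iff.2 (by
        have := pl1_nonneg (x₀ - x₀)
        have := delta1_nonneg (by norm_num : (0:ℝ) ≤ 2) hκ'0 hMd
        nlinarith)
    have hN : 0 ≤ Real.exp ((κ' + 4) * R) * Real.exp (delta1 2 κ' (((M : ℕ) : ℝ) * ((4 : ℕ) : ℝ)) * (((M : ℕ) : ℝ) * ((4 : ℕ) : ℝ)) * 3) *
        K₀ (4 * 2 ^ 4) (2 * 4) * K₁ 4 (2 / 2) :=
      mul_nonneg (mul_nonneg (mul_nonneg (Real.exp_pos _).le (Real.exp_pos _).le) (K₀_pos _ _).le) (B12Decay510Window.K₁_nonneg 4 _)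
    calc _ ≤ Real.exp ((κ' + 4) * R) * Real.exp (delta1 2 κ' (((M : ℕ) : ℝ) * ((4 : ℕ) : ℝ)) * (((M : ℕ) : ℝ) * ((4 : ℕ) : ℝ)) * 3) *
          K₀ (4 * 2 ^ 4) (2 * 4) * K₁ 4 (2 / 2) * 1 := mul_le_mul_of_nonneg_left hexp1 hN
      _ = _ := by rw [hκ']; simp only [Nat.cast_ofNat, mul_one]; ring
  · -- the indicator of the local set is a soft weight
    show _ ≤ Real.exp ((κ' + 4) * R) * Real.exp (-κ' * torusTreeLen X.1) * Real.exp (-(2 : ℝ) * distCT (domCount (F.P K) M (k + 1)) M x₀ (nearT (M := M) x₀ X)) *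
      Real.exp (-(2 : ℝ) * distCT (domCount (F.P K) M (k + 1)) M x₀ (nearT (M := M) x₀ X))
    have hd := torusTreeLen_nonneg X.1
    have hdist := distCT_nonneg (N := domCount (F.P K) M (k + 1)) (M := M) x₀ (nearT (M := M) x₀ X)
    split_ifs with hp
    · positivity
    · rw [not_or, not_lt, not_lt] at hp
      rw [← Real.exp_add, ← Real.exp_add, ← Real.exp_add]
      refine Real.one_le_exp_iff.2 ?_
      have h1 : κ' * torusTreeLen X.1 ≤ κ' * R := mul_le_mul_of_nonneg_left hp.1 hκ'0
      have h2 : distCT (domCount (F.P K) M (k + 1)) M x₀ (nearT (M := M) x₀ X) ≤ R := hp.2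
      have e : (κ' + 4) * R + -κ' * torusTreeLen X.1 + -(2 : ℝ) * distCT (domCount (F.P K) M (k + 1)) M x₀ (nearT (M := M) x₀ X) +
          -(2 : ℝ) * distCT (domCount (F.P K) M (k + 1)) M x₀ (nearT (M := M) x₀ X) =
        (κ' * R - κ' * torusTreeLen X.1) + 4 * (R - distCT (domCount (F.P K) M (k + 1)) M x₀ (nearT (M := M) x₀ X)) := by ring
      rw [e]
      exact add_nonneg (by linarith) (by linarith)

end Count

/-! ## §4 W1-21's `GeometricIncrements` from a local domain matching + a per-term volume-independence rate -/

section Letter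

variable {𝔄 : Type*} [NormedRing 𝔄] [NormedAlgebra ℝ 𝔄] {V : Type*} [NormedAddCommGroup V] [NormedSpace ℝ V] {ι : Type*} [Fintype ι] {𝔸 : Type*}
variable (F : T4Family) (m' : ℕ) (M : ℕ) [NeZero M] (hM : M = F.L ^ m')
variable (S : (K : ℕ) → ClusterTower (F.P K) 𝔸 M) (emb : ReadingMaps F 𝔄 𝔸) (ρ : V →L[ℝ] 𝔄) (bV : Module.Basis ι ℝ V)

include hM in
open Classical in
/-- ★★★ **W1-21's FINITE-VOLUME STABILISATION LETTER FROM TERM-LEVEL DATA**: for W1-20's `localizedSum F S emb` on a window `W`: FILE 7's `C²` charts and K-uniform soft VALUE majorants at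
`(κ, δ₀)`, a LOCAL DOMAIN MATCHING `φ k K : 𝐃_{k+1}(T_K) → 𝐃_{k+1}(T_{K+1})` which for `K ≥ K_m` and `0 ≤ R ≤ c_ρK` is a bijection between the `R`-local domains of the two tori (DISPLAYED
lattice geometry), and a PER-TERM volume-independence rate `|polScalar(term_{K+1}(φ X))(z,0) − polScalar(term_K(X))(z,0)| ≤ A₁ω^K` on the `R`-local `X` (`K ≥ K_s`, `R ≤ c_ρK`; `0 < ω < 1`;
DISPLAYED, NODE A ∕ N10) ⇒ `GeometricIncrements F (localizedSum F S emb) ρ bV W r`, `r = max{ω^{1∕2}, e^{−ηc′}}`, `η = min{κ,δ₀}∕2`, `c′ = −log ω∕(2(a′+1))`, `a′ = max{2κ₀(64,8)+4, −log ω∕(2c_ρ)}`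
(`r < 1`: `twoScaleRate_lt_one`). [cite: Balaban1987RG1, (1.7) p.261 and (1.20)-(1.21) p.264; Balaban1988RG2Cluster, (2.13)-(2.14) pp.14-15] -/
theorem geometricIncrements_localizedSum_of_termwiseVolumeRate (W : Set (ℕ → ℝ)) {κ δ₀ ω cρ : ℝ} (hκ0 : 0 < κ) (hδ₀ : 0 < δ₀)
    (hκ : kappa₀ (4 * 2 ^ 4) (2 * 4) ≤ κ / 2 / 2) (hω : 0 < ω) (hω1 : ω < 1) (hcρ : 0 < cρ)
    (hC : ∀ g ∈ W, ∀ (k K : ℕ) (X : (domSys (F.P K) M (k + 1)).Dom), ContDiffAt ℝ 2 (expChart (fun W' => (((S K) k).E (histPrefix g k) (emb K k W') X).re) ρ) 0)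
    (hval : ∀ g ∈ W, ∀ (k : ℕ) (μ ν : Fin 4) (z : Fin 4 → ℤ), ∃ CE : ℝ, 0 ≤ CE ∧ ∀ (K : ℕ) (X : (domSys (F.P K) M (k + 1)).Dom) (c : ι),
      let e : Site (F.P K) (k + 1) → TPt 4 (domCount (F.P K) M (k + 1) * M) := fun x i => (ZMod.cast (x i) : ZMod (domCount (F.P K) M (k + 1) * M))
      |polComp ℝ (expChart (fun W' => (((S K) k).E (histPrefix g k) (emb K k W') X).re) ρ) bV (Fin.cast (F.P_d K).symm μ) (siteOfInt F K (k + 1) z) c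
          (Fin.cast (F.P_d K).symm ν) (siteOfInt F K (k + 1) 0) c| ≤
        CE * Real.exp (-κ * torusTreeLen X.1) * Real.exp (-δ₀ * distCT (domCount (F.P K) M (k + 1)) M (e (siteOfInt F K (k + 1) z)) (nearT (M := M) (e (siteOfInt F K (k + 1) z)) X)) *
          Real.exp (-δ₀ * distCT (domCount (F.P K) M (k + 1)) M (e (siteOfInt F K (k + 1) 0)) (nearT (M := M) (e (siteOfInt F K (k + 1) 0)) X)))
    (φ : (k K : ℕ) → (domSys (F.P K) M (k + 1)).Dom → (domSys (F.P (K + 1)) M (k + 1)).Dom)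
    (hφ : ∀ k : ℕ, ∃ Km : ℕ, ∀ K, Km ≤ K → ∀ R : ℝ, 0 ≤ R → R ≤ cρ * K →
      Set.BijOn (φ k K)
        ↑(Finset.univ.filter (fun X : (domSys (F.P K) M (k + 1)).Dom =>
          ¬ (R < torusTreeLen X.1 ∨ R < distCT (domCount (F.P K) M (k + 1)) M
            (fun i : Fin 4 => (ZMod.cast (siteOfInt F K (k + 1) 0 i) : ZMod (domCount (F.P K) M (k + 1) * M)))
            (nearT (M := M) (fun i : Fin 4 => (ZMod.cast (siteOfInt F K (k + 1) 0 i) : ZMod (domCount (F.P K) M (k + 1) * M))) X))))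
        ↑(Finset.univ.filter (fun X : (domSys (F.P (K + 1)) M (k + 1)).Dom =>
          ¬ (R < torusTreeLen X.1 ∨ R < distCT (domCount (F.P (K + 1)) M (k + 1)) M
            (fun i : Fin 4 => (ZMod.cast (siteOfInt F (K + 1) (k + 1) 0 i) : ZMod (domCount (F.P (K + 1)) M (k + 1) * M)))
            (nearT (M := M) (fun i : Fin 4 => (ZMod.cast (siteOfInt F (K + 1) (k + 1) 0 i) : ZMod (domCount (F.P (K + 1)) M (k + 1) * M))) X)))))
    (hterm : ∀ g ∈ W, ∀ (k : ℕ) (μ ν : Fin 4) (z : Fin 4 → ℤ), ∃ (Ks : ℕ) (A₁ : ℝ), 0 ≤ A₁ ∧ ∀ K, Ks ≤ K → ∀ R : ℝ, 0 ≤ R → R ≤ cρ * K →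
      ∀ X ∈ Finset.univ.filter (fun X : (domSys (F.P K) M (k + 1)).Dom =>
          ¬ (R < torusTreeLen X.1 ∨ R < distCT (domCount (F.P K) M (k + 1)) M
            (fun i : Fin 4 => (ZMod.cast (siteOfInt F K (k + 1) 0 i) : ZMod (domCount (F.P K) M (k + 1) * M)))
            (nearT (M := M) (fun i : Fin 4 => (ZMod.cast (siteOfInt F K (k + 1) 0 i) : ZMod (domCount (F.P K) M (k + 1) * M))) X))),
        |polScalar (fun W' => (((S (K + 1)) k).E (histPrefix g k) (emb (K + 1) k W') (φ k K X)).re) ρ bV (Fin.cast (F.P_d (K + 1)).symm μ) (siteOfInt F (K + 1) (k + 1) z)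
            (Fin.cast (F.P_d (K + 1)).symm ν) (siteOfInt F (K + 1) (k + 1) 0) -
          polScalar (fun W' => (((S K) k).E (histPrefix g k) (emb K k W') X).re) ρ bV (Fin.cast (F.P_d K).symm μ) (siteOfInt F K (k + 1) z)
            (Fin.cast (F.P_d K).symm ν) (siteOfInt F K (k + 1) 0)| ≤ A₁ * ω ^ K) :
    GeometricIncrements F (localizedSum F S emb) ρ bV W
      (max (Real.exp (Real.log ω / 2))
        (Real.exp (-(min κ δ₀ / 2) * (-Real.log ω / (2 * (max (2 * kappa₀ (4 * 2 ^ 4) (2 * 4) + 4) (-Real.log ω / (2 * cρ)) + 1)))))) := by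
  intro g hg k μ ν z
  obtain ⟨CE, hCE, hv⟩ := hval g hg k μ ν z
  obtain ⟨Km, hm⟩ := hφ k
  obtain ⟨Ks, A₁, hA₁, hs⟩ := hterm g hg k μ ν z
  obtain ⟨Kt, hKt⟩ := eventually_atTop.1 (eventually_forall_abs_polWindow_sub_localTruncated_le F m' M hM S emb ρ bV k (histPrefix g k) μ ν z (hC g hg k) hCE hκ0.le hδ₀ hκ hv)
  have hk0 : 0 ≤ kappa₀ (4 * 2 ^ 4) (2 * 4) := kappa₀_nonneg (by norm_num) _
  set a' : ℝ := max (2 * kappa₀ (4 * 2 ^ 4) (2 * 4) + 4) (-Real.log ω / (2 * cρ)) with ha'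
  have ha'0 : 0 ≤ a' := le_max_of_le_left (by positivity)
  have ha'1 : 2 * kappa₀ (4 * 2 ^ 4) (2 * 4) + 4 ≤ a' := le_max_left _ _
  have hc'ρ : -Real.log ω / (2 * (a' + 1)) ≤ cρ := twoScale_c_le hω hω1 hcρ (le_max_right _ _)
  have hc'0 : 0 ≤ -Real.log ω / (2 * (a' + 1)) := by
    have := Real.log_neg hω hω1
    exact div_nonneg (by linarith) (by linarith)
  set N₀ : ℝ := Real.exp (delta1 2 (2 * kappa₀ (4 * 2 ^ 4) (2 * 4)) ((M : ℝ) * 4) * ((M : ℝ) * 4) * 3) * K₀ (4 * 2 ^ 4) (2 * 4) * K₁ 4 (2 / 2) with hN₀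
  have hN₀0 : 0 ≤ N₀ := by
    rw [hN₀]; exact mul_nonneg (mul_nonneg (Real.exp_pos _).le (K₀_pos _ _).le) (B12Decay510Window.K₁_nonneg 4 _)
  set Ct : ℝ := CE * Real.exp (delta1 (δ₀ / 2) (κ / 2) ((M : ℝ) * 4) * ((M : ℝ) * 4) * 3) * K₀ (4 * 2 ^ 4) (2 * 4) * K₁ 4 (δ₀ / 2 / 2) *
    Real.exp (-(delta1 (δ₀ / 2) (κ / 2) ((M : ℝ) * 4) * l1 z)) with hCt
  have hCt0 : 0 ≤ Ct := by
    rw [hCt]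
    have hK1 : 0 ≤ K₁ 4 (δ₀ / 2 / 2) := B12Decay510Window.K₁_nonneg 4 (δ₀ / 2 / 2)
    exact mul_nonneg (mul_nonneg (mul_nonneg (mul_nonneg hCE (Real.exp_pos _).le) (K₀_pos _ _).le) hK1) (Real.exp_pos _).le
  refine ⟨max Kt (max Km Ks), 2 * Ct + N₀ * A₁, fun K hK => ?_⟩
  have hKt' : Kt ≤ K := le_of_max_le_left hK
  have hKm' : Km ≤ K := le_of_max_le_left (le_of_max_le_right hK)
  have hKs' : Ks ≤ K := le_of_max_le_right (le_of_max_le_right hK)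
  refine abs_sub_le_geometric_of_twoScale_diag (u := fun K => polWindow F K (k + 1) (localizedSum F S emb k (histPrefix g k) K) ρ bV μ ν z)
    (s := fun R K => ∑ X ∈ Finset.univ.filter (fun X : (domSys (F.P K) M (k + 1)).Dom =>
        ¬ (R < torusTreeLen X.1 ∨ R < distCT (domCount (F.P K) M (k + 1)) M
          (fun i : Fin 4 => (ZMod.cast (siteOfInt F K (k + 1) 0 i) : ZMod (domCount (F.P K) M (k + 1) * M)))
          (nearT (M := M) (fun i : Fin 4 => (ZMod.cast (siteOfInt F K (k + 1) 0 i) : ZMod (domCount (F.P K) M (k + 1) * M))) X))),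
        polScalar (fun W' => (((S K) k).E (histPrefix g k) (emb K k W') X).re) ρ bV (Fin.cast (F.P_d K).symm μ) (siteOfInt F K (k + 1) z)
          (Fin.cast (F.P_d K).symm ν) (siteOfInt F K (k + 1) 0))
    (K₁ := max Kt (max Km Ks)) hCt0 (mul_nonneg hN₀0 hA₁) ha'0 hω hω1
    (fun K' hK' R hR => (hKt K' (le_of_max_le_left hK') R hR).trans (le_of_eq (by rw [hCt]; ring))) (fun K' hK' => ?_) K hK
  -- the diagonal stability at `R := c′K′ ≤ c_ρ K′`: matching + per-term rate + the local count
  have hKm'' : Km ≤ K' := le_of_max_le_left (le_of_max_le_right hK')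
  have hKs'' : Ks ≤ K' := le_of_max_le_right (le_of_max_le_right hK')
  have hR0 : 0 ≤ -Real.log ω / (2 * (a' + 1)) * K' := mul_nonneg hc'0 (Nat.cast_nonneg K')
  have hRρ : -Real.log ω / (2 * (a' + 1)) * K' ≤ cρ * K' := mul_le_mul_of_nonneg_right hc'ρ (Nat.cast_nonneg K')
  have hbij := hm K' hKm'' _ hR0 hRρ
  have hcard := card_localDomains_le F M k K' (-Real.log ω / (2 * (a' + 1)) * K')
  refine (abs_sum_sub_sum_le_card_mul_of_bijOn _ _ (φ k K') hbij _ _ (fun X hX => hs K' hKs'' _ hR0 hRρ X hX)).trans ?_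
  have hωK : 0 ≤ A₁ * ω ^ K' := mul_nonneg hA₁ (pow_nonneg hω.le _)
  refine (mul_le_mul_of_nonneg_right hcard hωK).trans ?_
  have hexp : Real.exp ((2 * kappa₀ (4 * 2 ^ 4) (2 * 4) + 4) * (-Real.log ω / (2 * (a' + 1)) * K')) ≤
      Real.exp (a' * (-Real.log ω / (2 * (a' + 1)) * K')) := Real.exp_le_exp.2 (mul_le_mul_of_nonneg_right ha'1 hR0)
  calc Real.exp ((2 * kappa₀ (4 * 2 ^ 4) (2 * 4) + 4) * (-Real.log ω / (2 * (a' + 1)) * K')) * N₀ * (A₁ * ω ^ K')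
      ≤ Real.exp (a' * (-Real.log ω / (2 * (a' + 1)) * K')) * N₀ * (A₁ * ω ^ K') :=
        mul_le_mul_of_nonneg_right (mul_le_mul_of_nonneg_right hexp hN₀0) hωK
    _ = N₀ * A₁ * Real.exp (a' * (-Real.log ω / (2 * (a' + 1)) * K')) * ω ^ K' := by ring

end Letter

/-! ## §5 AT THE RECORD, Stage 13, under W1-20's law -/

section Record

open scoped Matrix.Norms.L2Operator

variable {𝔸 : Type*} (F : T4Family) (N : ℕ) [NeZero N] (m' : ℕ) (M : ℕ) [NeZero M] (hM : M = F.L ^ m')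

include hM in
open Classical in
/-- ★★★ **W1-21's LETTER OF RECORD FROM TERM-LEVEL DATA**: under W1-20's law `Localizes17OfRecord₁₃ F N θ S emb`, the terms' `C²` charts in the record's β-chart, K-uniform soft value
majorants, the local domain matching (displayed geometry) and the per-term volume-independence rate ⇒ `GeometricIncrementsOfRecord₁₃ F N θ r` (def-W1's
`geometricIncrementsOfRecord₁₃_iff_of_localizes`); the `hinc` row of the finite-volume bills and the (P2) row of the g10 package, now TERM-level.
[cite: Balaban1987RG1, (1.7) p.261 and (1.21) p.264; Balaban1988RG2Cluster, (2.14) p.15] -/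
theorem geometricIncrementsOfRecord₁₃_of_termwiseVolumeRate (θ : Stage13Params F N) (S : (K : ℕ) → ClusterTower (F.P K) 𝔸 M) (emb : ReadingMaps F (MatA N) 𝔸)
    (hloc : Localizes17OfRecord₁₃ F N θ S emb) {κ δ₀ ω cρ : ℝ} (hκ0 : 0 < κ) (hδ₀ : 0 < δ₀) (hκ : kappa₀ (4 * 2 ^ 4) (2 * 4) ≤ κ / 2 / 2) (hω : 0 < ω) (hω1 : ω < 1)
    (hcρ : 0 < cρ)
    (hC : letI := θ.instVβ₁; letI := θ.instVβ₂
      ∀ g ∈ Window θ.γ, ∀ (k K : ℕ) (X : (domSys (F.P K) M (k + 1)).Dom),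
        ContDiffAt ℝ 2 (expChart (fun W' => (((S K) k).E (histPrefix g k) (emb K k W') X).re) θ.ρ8) 0)
    (hval : letI := θ.instVβ₁; letI := θ.instVβ₂; letI := θ.instιβ
      ∀ g ∈ Window θ.γ, ∀ (k : ℕ) (μ ν : Fin 4) (z : Fin 4 → ℤ), ∃ CE : ℝ, 0 ≤ CE ∧ ∀ (K : ℕ) (X : (domSys (F.P K) M (k + 1)).Dom) (c : θ.ιβ),
        let e : Site (F.P K) (k + 1) → TPt 4 (domCount (F.P K) M (k + 1) * M) := fun x i => (ZMod.cast (x i) : ZMod (domCount (F.P K) M (k + 1) * M))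
        |polComp ℝ (expChart (fun W' => (((S K) k).E (histPrefix g k) (emb K k W') X).re) θ.ρ8) θ.bV (Fin.cast (F.P_d K).symm μ) (siteOfInt F K (k + 1) z) c
            (Fin.cast (F.P_d K).symm ν) (siteOfInt F K (k + 1) 0) c| ≤
          CE * Real.exp (-κ * torusTreeLen X.1) * Real.exp (-δ₀ * distCT (domCount (F.P K) M (k + 1)) M (e (siteOfInt F K (k + 1) z)) (nearT (M := M) (e (siteOfInt F K (k + 1) z)) X)) *
            Real.exp (-δ₀ * distCT (domCount (F.P K) M (k + 1)) M (e (siteOfInt F K (k + 1) 0)) (nearT (M := M) (e (siteOfInt F K (k + 1) 0)) X)))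
    (φ : (k K : ℕ) → (domSys (F.P K) M (k + 1)).Dom → (domSys (F.P (K + 1)) M (k + 1)).Dom)
    (hφ : ∀ k : ℕ, ∃ Km : ℕ, ∀ K, Km ≤ K → ∀ R : ℝ, 0 ≤ R → R ≤ cρ * K →
      Set.BijOn (φ k K)
        ↑(Finset.univ.filter (fun X : (domSys (F.P K) M (k + 1)).Dom =>
          ¬ (R < torusTreeLen X.1 ∨ R < distCT (domCount (F.P K) M (k + 1)) M
            (fun i : Fin 4 => (ZMod.cast (siteOfInt F K (k + 1) 0 i) : ZMod (domCount (F.P K) M (k + 1) * M)))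
            (nearT (M := M) (fun i : Fin 4 => (ZMod.cast (siteOfInt F K (k + 1) 0 i) : ZMod (domCount (F.P K) M (k + 1) * M))) X))))
        ↑(Finset.univ.filter (fun X : (domSys (F.P (K + 1)) M (k + 1)).Dom =>
          ¬ (R < torusTreeLen X.1 ∨ R < distCT (domCount (F.P (K + 1)) M (k + 1)) M
            (fun i : Fin 4 => (ZMod.cast (siteOfInt F (K + 1) (k + 1) 0 i) : ZMod (domCount (F.P (K + 1)) M (k + 1) * M)))
            (nearT (M := M) (fun i : Fin 4 => (ZMod.cast (siteOfInt F (K + 1) (k + 1) 0 i) : ZMod (domCount (F.P (K + 1)) M (k + 1) * M))) X)))))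
    (hterm : letI := θ.instVβ₁; letI := θ.instVβ₂; letI := θ.instιβ
      ∀ g ∈ Window θ.γ, ∀ (k : ℕ) (μ ν : Fin 4) (z : Fin 4 → ℤ), ∃ (Ks : ℕ) (A₁ : ℝ), 0 ≤ A₁ ∧ ∀ K, Ks ≤ K → ∀ R : ℝ, 0 ≤ R → R ≤ cρ * K →
        ∀ X ∈ Finset.univ.filter (fun X : (domSys (F.P K) M (k + 1)).Dom =>
            ¬ (R < torusTreeLen X.1 ∨ R < distCT (domCount (F.P K) M (k + 1)) M
              (fun i : Fin 4 => (ZMod.cast (siteOfInt F K (k + 1) 0 i) : ZMod (domCount (F.P K) M (k + 1) * M)))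
              (nearT (M := M) (fun i : Fin 4 => (ZMod.cast (siteOfInt F K (k + 1) 0 i) : ZMod (domCount (F.P K) M (k + 1) * M))) X))),
          |polScalar (fun W' => (((S (K + 1)) k).E (histPrefix g k) (emb (K + 1) k W') (φ k K X)).re) θ.ρ8 θ.bV (Fin.cast (F.P_d (K + 1)).symm μ)
              (siteOfInt F (K + 1) (k + 1) z) (Fin.cast (F.P_d (K + 1)).symm ν) (siteOfInt F (K + 1) (k + 1) 0) -
            polScalar (fun W' => (((S K) k).E (histPrefix g k) (emb K k W') X).re) θ.ρ8 θ.bV (Fin.cast (F.P_d K).symm μ) (siteOfInt F K (k + 1) z)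
              (Fin.cast (F.P_d K).symm ν) (siteOfInt F K (k + 1) 0)| ≤ A₁ * ω ^ K) :
    GeometricIncrementsOfRecord₁₃ F N θ
      (max (Real.exp (Real.log ω / 2))
        (Real.exp (-(min κ δ₀ / 2) * (-Real.log ω / (2 * (max (2 * kappa₀ (4 * 2 ^ 4) (2 * 4) + 4) (-Real.log ω / (2 * cρ)) + 1)))))) := by
  letI := θ.instVβ₁; letI := θ.instVβ₂; letI := θ.instιβ
  exact (geometricIncrementsOfRecord₁₃_iff_of_localizes F N θ S emb hloc _).2
    (geometricIncrements_localizedSum_of_termwiseVolumeRate F m' M hM S emb θ.ρ8 θ.bV (Window θ.γ) hκ0 hδ₀ hκ hω hω1 hcρ hC hval φ hφ hterm)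

end Record

end YMDAG.N18.LocalStabilityRateOfTermwise

end
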